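import Summits.QuantumFields.BalabanUV.T4Continuum.Support.DirichletDirectionalBesovCutoff
import Summits.QuantumFields.BalabanUV.Beta.GAN24.DirichletBoxCompression
import Summits.QuantumFields.BalabanUV.Beta.GAN24.DirichletBoxPairingBound

/-!
# `BalabanUV.T4Continuum.Support.DirichletBesovTwoLevel` — NE2 (node U1a) formalisation swarm, SUPPLIER item «Δ1-BESOV» under the
# owner's sub-row `T4-U1a.S-NE2-D1-DIRICHLET°` (wall `hinj`): module (III) — THE DIRICHLET TWO-LEVEL INJECTED LAW FOR THE `U = 1`
# SCALAR MODEL AT THE GEOMETRIC RATE `√R/√N`, ON EVERY REGION CARRYING ADMISSIBLE DIRECTIONAL CUTOFFS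
# (unit b2b-balaban-t4-ne2-formalise-leaf-08, gen 3, v1)

HONEST FRAMING.  Rung (B)+1 bookkeeping at MODEL level (U = 1 scalar layer `Δ′ = Δ + a′Π′`, King's planting `J₀`), finite torus;
NE2 (U1a) is NOT proved by this file; spine PROVED 0/9 unchanged; NOT infinite volume, NOT the mass gap, NOT Clay.  HONEST DEPENDENCY
(verbatim): «continuum YM on T⁴ ⇐ BetaPertH ∧ nine spine estimates (0/9 proved); BetaPertH ⇐ (D1) ∧ (D4) ∧ CAP+tail; G-an2-4 gates
asym, D1 and NE2/3/4.»

WHAT THIS FILE PROVES (0 sorry; the gan24-p2 lineage's compression ∕ pairing modules and module (I) BY NAME, nothing restated).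
For a region `Ω` of the level-`N` torus, its refinement `Ω′ = refineR Ω` and the compressed (Dirichlet, zero outside, boundary = first
exterior layer) scalar operators `D^Ω = (Δ′_N)_{ΩΩ}`, `D′^{Ω′} = (Δ′_{RN})_{Ω′Ω′}`, compressed planting `J^Ω = (J₀)_{Ω′Ω}`
(`Beta/GAN24/DirichletBoxCompression.{DOm, JOm, refineR}` — [Balaban1985BackgroundPropagators] (3.24)/(3.27) p. 394 at `U = 1`):

 * §1 **`nsq_Pdir_solExt_le`**: if the axis `μ` carries an ADMISSIBLE CUTOFF for `Ω′` at the unit scale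
   (`AdmissibleCutoff (fine (RN) M) Ω′ μ ψ (κ₁/(RN)) (κ₂/(RN)²)`, module (I)), then the zero-extended fine Dirichlet solution
   `v = solExt′ w` obeys `‖∂′_μᴴ∂′_μ v‖² ≤ 8·(RN)·K₁·K₂·‖w‖²` with `K₁ = √(2γ′⁻¹ + 2dκ₁²γ′⁻²)`,
   `K₂ = √(2(1 + (a′γ′⁻¹)²)) + d·(2κ₁√γ′⁻¹ + κ₂γ′⁻¹)` (module (I)'s END fed with gan24's energy bounds `dirichlet_solExt_le`,
   `nsq_solExt_le`, `sum_normSq_LapS_solExt_le`) — ONE power of the fine lattice factor, no convexity;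
 * §2 **THE END `opNorm_defect_le_of_admissibleCutoffs`**: if EVERY axis carries such a cutoff, then
   `‖(D′^{Ω′})⁻¹·J^Ω − J^Ω·(D^Ω)⁻¹‖ ≤ besovConst(d, a′, κ₁, κ₂) · √R / √N`
   (gan24's `form_defect` + (C-glob) `norm_pairing_le` + `nsq_sdiff_solExt_le` + §1 + `opNorm_le_of_pairing`) — the owner's wall
   `hinj` ∕ `hinjS` SHAPE for the scalar carriers, at the rate `N^{−1/2}` instead of `N^{−1}`: along the tower `N = L^k`, `R = L` this is
   `e₁ k = besovConst·√L·(L^{−1/2})^k`, GEOMETRIC with `θ = L^{−1/2} ∈ [L⁻¹, 1)`, hence consumable by every general-rate END of row B8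
   (`DirichletFreeTower.towerLimitRate_dirichlet_of_injected`, the owner's O12-b `towerLimitRate_dirichletScalar_of_injected`).
   Module (II) (`DirichletMonotoneCutoff`) constructs the cutoffs with `κ₁ = K₁(d)`, `κ₂ = K₂(d)` for every LOCALLY MONOTONE union of
   unit blocks (L-shapes, complements of boxes, Fichera corners, every coordinate-product set …), where `H²` fails at re-entrant edges.

ABSOLUTE RULE (cell, verbatim): «No internally-minted statement may enter as a cited fact. Every hypothesis is either kernel-proved in
this package or a verbatim quotation of a PUBLISHED theorem with page reference. The manuscript(s) under audit are NOT citable for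
their own disputed steps — they are the thing under adjudication; programme-internal (2001/route/tribunal) claims are never citable.»
[folklore] finite-dimensional analysis; the cutoff family is a DISPLAYED hypothesis (structure on data), no `def … : Prop` fact.
NOT CLAIMED: rate `N^{−1}` (leaf-07-g4's numerics `t4/T4-EST-NE2-D1-INJ.md`: the measured exponent is 1 — this method gives 1/2); the
VECTOR operator `calDalev` ∕ the printed gauge term (owner's located delta G-ne2p1-g12-1); NE2; NE3; «not in print; our proof».
-/

noncomputable section

open scoped BigOperators ComplexConjugate Matrix Matrix.Norms.L2Operator
open Finset

namespace Summit.QuantumFields.BalabanUV.T4Continuum.DirichletBesovTwoLevel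

open Literature.MathematicalPhysics.QuantumFieldTheory.Balaban1983to89.B5Prop11Plancherel (Tor fine unitVec)
open Literature.MathematicalPhysics.QuantumFieldTheory.Balaban1983to89.B5Action121 (sdiff LapS)
open Literature.MathematicalPhysics.QuantumFieldTheory.Balaban1983to89.B5Prop11Lower (nsq nsq_nonneg)
open Summit.QuantumFields.BalabanUV.T4Continuum.ScalarAveragedPropagator (gammaPs gammaPs_pos dirichlet)
open Summit.QuantumFields.BalabanUV.T4Continuum.DirichletDirectionalBesovCutoff (AdmissibleCutoff nsq_sdiffH_sdiff_le energy)
open Summit.QuantumFields.BalabanUV.Beta.GAN24.DirichletBoxRegularity (Pdir)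
open Summit.QuantumFields.BalabanUV.Beta.GAN24.DirichletBoxCompression (DOm JOm refineR solExt solExt_apply_of_not form_defect
  nsq_sdiff_solExt_le dirichlet_solExt_le nsq_solExt_le sum_normSq_LapS_solExt_le opNorm_le_of_pairing)
open Summit.QuantumFields.BalabanUV.Beta.GAN24.DirichletBoxPairing (norm_pairing_le)

variable {d : ℕ}

/-! ## §1 The second-difference budget of the fine Dirichlet solution under an admissible cutoff -/

/-- the energy-side constant `K₁ = √(2γ′⁻¹ + 2dκ₁²γ′⁻²)`. [folklore] -/
def K1 (d : ℕ) (a' κ₁ : ℝ) : ℝ := Real.sqrt (2 * (gammaPs d a')⁻¹ + 2 * d * κ₁ ^ 2 * (gammaPs d a')⁻¹ ^ 2)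

/-- the datum-side constant `K₂ = √(2(1 + (a′γ′⁻¹)²)) + d(2κ₁√γ′⁻¹ + κ₂γ′⁻¹)`. [folklore] -/
def K2 (d : ℕ) (a' κ₁ κ₂ : ℝ) : ℝ :=
  Real.sqrt (2 * (1 + (a' * (gammaPs d a')⁻¹) ^ 2)) + d * (2 * κ₁ * Real.sqrt ((gammaPs d a')⁻¹) + κ₂ * (gammaPs d a')⁻¹)

/-- `K₁ ≥ 0`. [folklore] -/
theorem K1_nonneg (d : ℕ) (a' κ₁ : ℝ) : 0 ≤ K1 d a' κ₁ := Real.sqrt_nonneg _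

/-- `K₂ ≥ 0` for `κ₁, κ₂ ≥ 0`, `a′ > 0`. [folklore] -/
theorem K2_nonneg (d : ℕ) {a' κ₁ κ₂ : ℝ} (ha' : 0 < a') (hκ₁ : 0 ≤ κ₁) (hκ₂ : 0 ≤ κ₂) : 0 ≤ K2 d a' κ₁ κ₂ := by
  have hγ := (gammaPs_pos (d := d) (a' := a')).1
  have := ha'
  unfold K2; positivity

section OneLevel

variable (n : ℕ) [NeZero n] (M : Fin d → ℕ) [hM : ∀ μ, NeZero (M μ)] (a' : ℝ) (Ω : Tor (fine n M) → Prop) [DecidablePred Ω]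

/-- **THE SECOND-DIFFERENCE BUDGET**: under an admissible `μ`-cutoff for `Ω` at the unit scale (`ℓ₁ = κ₁/n`, `ℓ₂ = κ₂/n²`), the
zero-extended Dirichlet solution `u = solExt f` obeys `‖∂_μᴴ∂_μ u‖² ≤ 8·n·K₁·K₂·‖f‖²` — ONE power of the lattice factor `n`. [folklore] -/
theorem nsq_Pdir_solExt_le (ha' : 0 < a') {κ₁ κ₂ : ℝ} (hκ₁ : 0 ≤ κ₁) (hκ₂ : 0 ≤ κ₂) {μ : Fin d} {ψ : Tor (fine n M) → ℝ}
    (hψ : AdmissibleCutoff (fine n M) Ω μ ψ (κ₁ / n) (κ₂ / (n : ℝ) ^ 2)) (f : {x // Ω x} → ℂ) :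
    nsq (Pdir (fine n M) (n : ℂ) μ *ᵥ solExt n M a' Ω f) ≤ 8 * n * K1 d a' κ₁ * K2 d a' κ₁ κ₂ * nsq f := by
  have hγ := (gammaPs_pos (d := d) (a' := a')).1
  have hn0 : (n : ℝ) ≠ 0 := by exact_mod_cast NeZero.ne n
  have hnpos : 0 < (n : ℝ) := by positivity
  have hc : ((n : ℕ) : ℂ) ≠ 0 := by exact_mod_cast NeZero.ne n
  set u := solExt n M a' Ω f with hu
  have hz : ∀ x, ¬ Ω x → u x = 0 := fun x hx => solExt_apply_of_not n M a' Ω f hx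
  -- module (I)'s END, with `‖c‖ = n`
  have hmain := nsq_sdiffH_sdiff_le (fine n M) hψ ((n : ℕ) : ℂ) hc hz
  rw [Pdir, ← Matrix.mulVec_mulVec]
  refine hmain.trans ?_
  rw [Complex.norm_natCast]
  -- the three budgets from the compression module
  set W := Real.sqrt (nsq f) with hW
  have hW0 : 0 ≤ W := Real.sqrt_nonneg _
  have hW2 : W ^ 2 = nsq f := Real.sq_sqrt (nsq_nonneg f)
  have hE : energy (fine n M) ((n : ℕ) : ℂ) u ≤ (gammaPs d a')⁻¹ * nsq f := dirichlet_solExt_le n M a' Ω ha' f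
  have hZ : nsq u ≤ (gammaPs d a')⁻¹ ^ 2 * nsq f := nsq_solExt_le n M a' Ω ha' f
  have hG : nsq (fun b : {x // Ω x} => (LapS (fine n M) ((n : ℕ) : ℂ) *ᵥ u) b) ≤ 2 * (1 + (a' * (gammaPs d a')⁻¹) ^ 2) * nsq f :=
    sum_normSq_LapS_solExt_le n M a' Ω ha' f
  have he : ∀ ν, Real.sqrt (nsq (sdiff (fine n M) ((n : ℕ) : ℂ) ν *ᵥ u)) ≤ Real.sqrt ((gammaPs d a')⁻¹) * W := fun ν => by
    rw [hW, ← Real.sqrt_mul (inv_nonneg.mpr hγ.le)]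
    exact Real.sqrt_le_sqrt (nsq_sdiff_solExt_le n M a' Ω ha' f ν)
  -- first factor: `√(2E + 2d n²(κ₁/n)² Z) ≤ K₁·W`
  have h1 : Real.sqrt (2 * energy (fine n M) ((n : ℕ) : ℂ) u + 2 * d * (n : ℝ) ^ 2 * (κ₁ / n) ^ 2 * nsq u) ≤ K1 d a' κ₁ * W := by
    have hsimp : (n : ℝ) ^ 2 * (κ₁ / n) ^ 2 = κ₁ ^ 2 := by field_simp
    rw [mul_assoc (2 * (d : ℝ)) ((n : ℝ) ^ 2), hsimp, K1, hW, ← Real.sqrt_mul' _ (nsq_nonneg f)]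
    refine Real.sqrt_le_sqrt ?_
    have hd : (0 : ℝ) ≤ d := Nat.cast_nonneg d
    nlinarith [hE, hZ, mul_nonneg hd (sq_nonneg κ₁), nsq_nonneg f]
  -- second factor: `√G + Σ_ν (2n(κ₁/n) e_ν + n²(κ₂/n²) √Z) ≤ K₂·W`
  have h2 : Real.sqrt (nsq (fun b : {x // Ω x} => (LapS (fine n M) ((n : ℕ) : ℂ) *ᵥ u) b))
        + ∑ ν : Fin d, (2 * (n : ℝ) * (κ₁ / n) * Real.sqrt (nsq (sdiff (fine n M) ((n : ℕ) : ℂ) ν *ᵥ u))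
            + (n : ℝ) ^ 2 * (κ₂ / (n : ℝ) ^ 2) * Real.sqrt (nsq u)) ≤ K2 d a' κ₁ κ₂ * W := by
    have hA : Real.sqrt (nsq (fun b : {x // Ω x} => (LapS (fine n M) ((n : ℕ) : ℂ) *ᵥ u) b))
        ≤ Real.sqrt (2 * (1 + (a' * (gammaPs d a')⁻¹) ^ 2)) * W := by
      rw [hW, ← Real.sqrt_mul (by positivity)]
      exact Real.sqrt_le_sqrt hG
    have hZ' : Real.sqrt (nsq u) ≤ (gammaPs d a')⁻¹ * W := by
      rw [hW, ← Real.sqrt_sq (inv_nonneg.mpr hγ.le), ← Real.sqrt_mul (sq_nonneg _)]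
      exact Real.sqrt_le_sqrt hZ
    have hterm : ∀ ν : Fin d, 2 * (n : ℝ) * (κ₁ / n) * Real.sqrt (nsq (sdiff (fine n M) ((n : ℕ) : ℂ) ν *ᵥ u))
          + (n : ℝ) ^ 2 * (κ₂ / (n : ℝ) ^ 2) * Real.sqrt (nsq u)
        ≤ (2 * κ₁ * Real.sqrt ((gammaPs d a')⁻¹) + κ₂ * (gammaPs d a')⁻¹) * W := by
      intro ν
      have e1 : 2 * (n : ℝ) * (κ₁ / n) = 2 * κ₁ := by field_simp
      have e2 : (n : ℝ) ^ 2 * (κ₂ / (n : ℝ) ^ 2) = κ₂ := by field_simp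
      rw [e1, e2]
      nlinarith [he ν, hZ', hκ₁, hκ₂]
    calc Real.sqrt (nsq (fun b : {x // Ω x} => (LapS (fine n M) ((n : ℕ) : ℂ) *ᵥ u) b))
          + ∑ ν : Fin d, (2 * (n : ℝ) * (κ₁ / n) * Real.sqrt (nsq (sdiff (fine n M) ((n : ℕ) : ℂ) ν *ᵥ u))
              + (n : ℝ) ^ 2 * (κ₂ / (n : ℝ) ^ 2) * Real.sqrt (nsq u))
        ≤ Real.sqrt (2 * (1 + (a' * (gammaPs d a')⁻¹) ^ 2)) * W
          + ∑ _ν : Fin d, (2 * κ₁ * Real.sqrt ((gammaPs d a')⁻¹) + κ₂ * (gammaPs d a')⁻¹) * W :=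
          add_le_add hA (Finset.sum_le_sum fun ν _ => hterm ν)
      _ = K2 d a' κ₁ κ₂ * W := by
          rw [Finset.sum_const, Finset.card_univ, Fintype.card_fin, nsmul_eq_mul, K2]; ring
  have hK1 := K1_nonneg d a' κ₁
  have hK2 := K2_nonneg d ha' hκ₁ hκ₂
  calc 8 * (n : ℝ) * Real.sqrt (2 * energy (fine n M) ((n : ℕ) : ℂ) u + 2 * d * (n : ℝ) ^ 2 * (κ₁ / n) ^ 2 * nsq u)
        * (Real.sqrt (nsq (fun b : {x // Ω x} => (LapS (fine n M) ((n : ℕ) : ℂ) *ᵥ u) b))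
          + ∑ ν : Fin d, (2 * (n : ℝ) * (κ₁ / n) * Real.sqrt (nsq (sdiff (fine n M) ((n : ℕ) : ℂ) ν *ᵥ u))
              + (n : ℝ) ^ 2 * (κ₂ / (n : ℝ) ^ 2) * Real.sqrt (nsq u)))
      ≤ 8 * (n : ℝ) * (K1 d a' κ₁ * W) * (K2 d a' κ₁ κ₂ * W) := by
        apply mul_le_mul (mul_le_mul_of_nonneg_left h1 (by positivity)) h2
          (add_nonneg (Real.sqrt_nonneg _) (Finset.sum_nonneg fun ν _ => by positivity))
        positivity
    _ = 8 * n * K1 d a' κ₁ * K2 d a' κ₁ κ₂ * nsq f := by rw [← hW2]; ring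

end OneLevel

/-! ## §2 THE END: the two-level injected law at rate `√R/√N` -/

/-- **the Besov two-level constant** `besovConst = 2d·√(8γ′⁻¹K₁K₂)`. [folklore] -/
def besovConst (d : ℕ) (a' κ₁ κ₂ : ℝ) : ℝ := 2 * d * Real.sqrt (8 * (gammaPs d a')⁻¹ * K1 d a' κ₁ * K2 d a' κ₁ κ₂)

/-- `besovConst ≥ 0`. [folklore] -/
theorem besovConst_nonneg (d : ℕ) (a' κ₁ κ₂ : ℝ) : 0 ≤ besovConst d a' κ₁ κ₂ := by unfold besovConst; positivity

section TwoLevel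

variable (N R : ℕ) [NeZero N] [NeZero R] (M : Fin d → ℕ) [hM : ∀ μ, NeZero (M μ)] (a' : ℝ)
  (Ω : Tor (fine N M) → Prop) [DecidablePred Ω]

/-- **THE DIRICHLET TWO-LEVEL INJECTED LAW AT RATE `√R/√N` (the END of «Δ1-BESOV» modulo the cutoffs)**: if every axis `μ` carries
an admissible cutoff for the refined region `Ω′` at the unit scale (`ℓ₁ = κ₁/(RN)`, `ℓ₂ = κ₂/(RN)²`), then
`‖(D′^{Ω′})⁻¹·J^Ω − J^Ω·(D^Ω)⁻¹‖ ≤ besovConst(d,a′,κ₁,κ₂)·√R/√N` — the owner's wall `hinj` (scalar carriers, gan24's M-E shape) at the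
geometric rate `θ = L^{−1/2}` along the tower `N = L^k`, `R = L`; no convexity of `Ω`. [folklore] -/
theorem opNorm_defect_le_of_admissibleCutoffs (ha' : 0 < a') (hN : 1 ≤ N) {κ₁ κ₂ : ℝ} (hκ₁ : 0 ≤ κ₁) (hκ₂ : 0 ≤ κ₂)
    (hψ : ∀ μ : Fin d, ∃ ψ : Tor (fine (R * N) M) → ℝ,
      AdmissibleCutoff (fine (R * N) M) (refineR N R M Ω) μ ψ (κ₁ / ((R * N : ℕ) : ℝ)) (κ₂ / ((R * N : ℕ) : ℝ) ^ 2)) :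
    ‖(DOm (R * N) M a' (refineR N R M Ω))⁻¹ * JOm N R M Ω - JOm N R M Ω * (DOm N M a' Ω)⁻¹‖
      ≤ besovConst d a' κ₁ κ₂ * Real.sqrt R / Real.sqrt N := by
  have hγ := (gammaPs_pos (d := d) (a' := a')).1
  have hNpos : 0 < (N : ℝ) := by exact_mod_cast hN
  have hRpos : 0 < (R : ℝ) := by exact_mod_cast Nat.pos_of_ne_zero (NeZero.ne R)
  have hK1 := K1_nonneg d a' κ₁
  have hK2 := K2_nonneg d ha' hκ₁ hκ₂
  have hB := besovConst_nonneg d a' κ₁ κ₂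
  refine opNorm_le_of_pairing _ (by positivity) fun w f => ?_
  rw [form_defect N R M a' Ω ha' w f]
  set v := solExt (R * N) M a' (refineR N R M Ω) w with hv
  set u := solExt N M a' Ω f with hu
  refine (norm_pairing_le N R M hN u v).trans ?_
  -- each summand: `√nsq(∂_μu)·√nsq(P_μ v) ≤ √γ′⁻¹·√nsq f · √(8 RN K₁K₂)·√nsq w`
  have hsum : ∀ μ : Fin d, Real.sqrt (nsq (sdiff (fine N M) (N : ℂ) μ *ᵥ u))
        * Real.sqrt (nsq (Pdir (fine (R * N) M) ((R * N : ℕ) : ℂ) μ *ᵥ v))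
      ≤ (Real.sqrt ((gammaPs d a')⁻¹) * Real.sqrt (nsq f))
        * (Real.sqrt (8 * ((R * N : ℕ) : ℝ) * K1 d a' κ₁ * K2 d a' κ₁ κ₂) * Real.sqrt (nsq w)) := by
    intro μ
    obtain ⟨ψ, hψμ⟩ := hψ μ
    refine mul_le_mul ?_ ?_ (Real.sqrt_nonneg _) (by positivity)
    · rw [← Real.sqrt_mul (inv_nonneg.mpr hγ.le)]
      exact Real.sqrt_le_sqrt (nsq_sdiff_solExt_le N M a' Ω ha' f μ)
    · rw [← Real.sqrt_mul (by positivity)]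
      exact Real.sqrt_le_sqrt (nsq_Pdir_solExt_le (R * N) M a' (refineR N R M Ω) ha' hκ₁ hκ₂ hψμ w)
  have hcast : ((R * N : ℕ) : ℝ) = (R : ℝ) * N := by push_cast; ring
  calc 2 / (N : ℝ) * ∑ μ, Real.sqrt (nsq (sdiff (fine N M) (N : ℂ) μ *ᵥ u))
          * Real.sqrt (nsq (Pdir (fine (R * N) M) ((R * N : ℕ) : ℂ) μ *ᵥ v))
      ≤ 2 / (N : ℝ) * ∑ _μ : Fin d, (Real.sqrt ((gammaPs d a')⁻¹) * Real.sqrt (nsq f))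
          * (Real.sqrt (8 * ((R * N : ℕ) : ℝ) * K1 d a' κ₁ * K2 d a' κ₁ κ₂) * Real.sqrt (nsq w)) :=
        mul_le_mul_of_nonneg_left (Finset.sum_le_sum fun μ _ => hsum μ) (by positivity)
    _ = besovConst d a' κ₁ κ₂ * Real.sqrt R / Real.sqrt N * Real.sqrt (nsq w) * Real.sqrt (nsq f) := by
        rw [Finset.sum_const, Finset.card_univ, Fintype.card_fin, nsmul_eq_mul, besovConst, hcast]
        have hsN : Real.sqrt (N : ℝ) ≠ 0 := (Real.sqrt_pos.mpr hNpos).ne'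
        have h8 : Real.sqrt (8 * ((R : ℝ) * N) * K1 d a' κ₁ * K2 d a' κ₁ κ₂)
            = Real.sqrt (8 * K1 d a' κ₁ * K2 d a' κ₁ κ₂) * Real.sqrt R * Real.sqrt N := by
          rw [← Real.sqrt_mul (by positivity), ← Real.sqrt_mul (by positivity)]; ring_nf
        have hg : Real.sqrt (8 * (gammaPs d a')⁻¹ * K1 d a' κ₁ * K2 d a' κ₁ κ₂)
            = Real.sqrt ((gammaPs d a')⁻¹) * Real.sqrt (8 * K1 d a' κ₁ * K2 d a' κ₁ κ₂) := by
          rw [← Real.sqrt_mul (inv_nonneg.mpr hγ.le)]; ring_nf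
        have hinv : 2 / (N : ℝ) * Real.sqrt N = 2 / Real.sqrt N := by
          rw [div_mul_eq_mul_div, div_eq_div_iff hNpos.ne' hsN, mul_assoc, Real.mul_self_sqrt hNpos.le]
        rw [h8, hg]
        calc 2 / (N : ℝ) * ((d : ℝ) * (Real.sqrt ((gammaPs d a')⁻¹) * Real.sqrt (nsq f)
              * (Real.sqrt (8 * K1 d a' κ₁ * K2 d a' κ₁ κ₂) * Real.sqrt R * Real.sqrt N * Real.sqrt (nsq w))))
            = (2 / (N : ℝ) * Real.sqrt N) * ((d : ℝ) * (Real.sqrt ((gammaPs d a')⁻¹) * Real.sqrt (nsq f))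
              * (Real.sqrt (8 * K1 d a' κ₁ * K2 d a' κ₁ κ₂) * Real.sqrt R * Real.sqrt (nsq w))) := by ring
          _ = 2 * d * (Real.sqrt ((gammaPs d a')⁻¹) * Real.sqrt (8 * K1 d a' κ₁ * K2 d a' κ₁ κ₂)) * Real.sqrt R / Real.sqrt N
              * Real.sqrt (nsq w) * Real.sqrt (nsq f) := by rw [hinv]; ring

end TwoLevel

end Summit.QuantumFields.BalabanUV.T4Continuum.DirichletBesovTwoLevel

end
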